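import Literature.AlgebraicTopology.SingularHomology.EilenbergZilberChains
import Literature.Geometry.Manifold.ShuffleCubeMaps
import Literature.Geometry.Manifold.SimplexIntegral
import HarnessLib

/-!
# Shuffle simplices of smooth simplices: smoothness, and the cube parametrisation as a product

Topic `Literature/Geometry/Manifold`. Manifold-side bookkeeping for the Eilenberg–Zilber shuffle
product (`…SingularHomology.EilenbergZilberChains`) of SMOOTH singular simplices
(`…SingularSimplex.IsSmooth`, `C^∞` within the closed simplex), as needed to integrate differential
forms over shuffle products (de Rham's theorem, multiplicative part):

* `SingularSimplex.bext_pairSimplex`, `IsSmooth.pairSimplex`, `IsSmooth.tupleSimplex` — the pair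
  simplex `(σ, τ)` of smooth simplices is smooth on `M × N`, and so are all tuple simplices
  `(σ ∘ [e_{a₀},…], τ ∘ [e_{b₀},…])` (affine reparametrisations);
* `EilenbergZilber.realize₂_mem_smoothChains` and corollaries: the shuffle product `σ × τ`, the
  Alexander–Whitney/Eilenberg–Zilber diagonal `AW(σ)`, the Eilenberg–Zilber homotopy `H(σ)` and
  the diagonal `(σ, σ)` of smooth simplices are SMOOTH chains of the product manifold
  (`awChain_mem_smoothChains`, `ezHChain_mem_smoothChains`, `diagChain_mem_smoothChains`);
* `EilenbergZilber.cubeMap_tupleSimplex` — **the cube parametrisation of a shuffle simplex is the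
  product of the cube parametrisations**: along a tuple `w` of `shuffle n p` (`p + q = n`),
  `(σ,τ)_w.cubeMap t = (σ.cubeMap (S_w t), τ.cubeMap (T_w t))` on the cube, with the monomial cube
  maps `S_w = cubeS`, `T_w = cubeT` of `…Manifold.ShuffleCubeMaps`.

Everything is proved; no named facts.

## References

* S. Eilenberg, S. Mac Lane, On the groups `H(Π,n)`. I, Ann. of Math. 58 (1953), §5. [folklore attribution]
* J. M. Lee, *Introduction to Smooth Manifolds*, 2nd ed. (2013), Ch. 18 pp. 473–481. [LeeSmoothManifolds2013]
-/

noncomputable section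

-- see "Implementation notes" in `…SingularHomology.SingularChainsConcrete`
set_option backward.isDefEq.respectTransparency false

open scoped Manifold ContDiff
open Set Literature.AlgebraicTopology.SingularHomology Literature.AlgebraicTopology.SingularHomology.ShuffleChains

universe u v

namespace Literature.AlgebraicTopology.SingularHomology.SingularSimplex

open Literature.Geometry.Manifold

variable {E : Type u} [NormedAddCommGroup E] [NormedSpace ℝ E] {H : Type*} [TopologicalSpace H]
  {I : ModelWithCorners ℝ E H} {M : Type u} [TopologicalSpace M] [ChartedSpace H M]
  {E' : Type u} [NormedAddCommGroup E'] [NormedSpace ℝ E'] {H' : Type*} [TopologicalSpace H']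
  {I' : ModelWithCorners ℝ E' H'} {N : Type u} [TopologicalSpace N] [ChartedSpace H' N] {n k p q : ℕ}

/-- The barycentric extension of a pair simplex is the pair of barycentric extensions. [folklore] -/
theorem bext_pairSimplex (σ : SingularSimplex M n) (τ : SingularSimplex N n) :
    (pairSimplex σ τ).bext = fun x ↦ (σ.bext x, τ.bext x) := by
  funext x
  by_cases hx : x ∈ stdSimplex ℝ (Fin (n + 1))
  · rw [bext_apply_of_mem _ hx, bext_apply_of_mem _ hx, bext_apply_of_mem _ hx, toContinuousMap_pairSimplex]
    rfl
  · rw [bext_apply_of_notMem _ hx, bext_apply_of_notMem _ hx, bext_apply_of_notMem _ hx, toContinuousMap_pairSimplex]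
    rfl

/-- **The pair simplex of smooth simplices is smooth** (componentwise smoothness within the closed
simplex). [cite: LeeSmoothManifolds2013, Ch. 18 p. 473] -/
theorem IsSmooth.pairSimplex {σ : SingularSimplex M n} {τ : SingularSimplex N n} (hσ : σ.IsSmooth I)
    (hτ : τ.IsSmooth I') : (pairSimplex σ τ).IsSmooth (I.prod I') := by
  unfold IsSmooth
  rw [bext_pairSimplex]
  exact hσ.prodMk hτ

/-- **Tuple (shuffle) simplices of smooth simplices are smooth**: they are pair simplices of affine
reparametrisations. [cite: LeeSmoothManifolds2013, Ch. 18 p. 473] -/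
theorem IsSmooth.tupleSimplex {σ : SingularSimplex M p} {τ : SingularSimplex N q} (hσ : σ.IsSmooth I)
    (hτ : τ.IsSmooth I') (w : Fin (k + 1) → V) : (EilenbergZilber.tupleSimplex σ τ w).IsSmooth (I.prod I') :=
  (hσ.compose _).pairSimplex (hτ.compose _)

end Literature.AlgebraicTopology.SingularHomology.SingularSimplex

namespace Literature.AlgebraicTopology.SingularHomology.EilenbergZilber

open Literature.Geometry.Manifold SingularSimplex

variable {E : Type u} [NormedAddCommGroup E] [NormedSpace ℝ E] {H : Type*} [TopologicalSpace H]
  {I : ModelWithCorners ℝ E H} {M : Type u} [TopologicalSpace M] [ChartedSpace H M]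
  {E' : Type u} [NormedAddCommGroup E'] [NormedSpace ℝ E'] {H' : Type*} [TopologicalSpace H']
  {I' : ModelWithCorners ℝ E' H'} {N : Type u} [TopologicalSpace N] [ChartedSpace H' N]
  (R : Type v) [CommRing R] (A : Type v) [AddCommGroup A] [Module R A] {n k p q : ℕ}

/-! ### Shuffle products of smooth simplices are smooth chains -/

/-- **Realizations against smooth simplices are smooth chains** of `M × N`. [folklore] -/
theorem realize₂_mem_smoothChains {σ : SingularSimplex M p} {τ : SingularSimplex N q} (hσ : σ.IsSmooth I)
    (hτ : τ.IsSmooth I') (x : TupleChain V k) (m : A) :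
    realize₂ R A σ τ k x m ∈ smoothChains (I.prod I') R A (M × N) k := by
  induction x using Finsupp.induction_linear with
  | zero => simp
  | add x y hx hy => rw [map_add, LinearMap.add_apply]; exact Submodule.add_mem _ hx hy
  | single w z =>
    rw [realize₂_single]
    exact Submodule.smul_of_tower_mem _ z (single_mem_smoothChains (hσ.tupleSimplex hτ w) m)

/-- The shuffle product of smooth simplices is a smooth chain. [folklore] -/
theorem ezMap_mem_smoothChains {σ : SingularSimplex M p} {τ : SingularSimplex N q} (hσ : σ.IsSmooth I)
    (hτ : τ.IsSmooth I') (m : A) : ezMap R A n σ τ m ∈ smoothChains (I.prod I') R A (M × N) n :=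
  realize₂_mem_smoothChains R A hσ hτ _ m

variable {R A}

/-- `AW` of a smooth chain is a smooth chain of `M × M`. [folklore] -/
theorem awChain_mem_smoothChains {c : CChain A M k} (hc : c ∈ smoothChains I R A M k) :
    awChain R A M k c ∈ smoothChains (I.prod I) R A (M × M) k := by
  classical
  have hc' := (mem_smoothChains_iff c).1 hc
  have hsum : (∑ σ ∈ c.support, Finsupp.single σ (c σ)) = c := Finsupp.sum_single c
  rw [← hsum, map_sum]
  refine Submodule.sum_mem _ fun σ hσ ↦ ?_
  rw [awChain_single, awMap]
  exact realize₂_mem_smoothChains R A (hc' σ hσ) (hc' σ hσ) _ _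

/-- The Eilenberg–Zilber homotopy of a smooth chain is a smooth chain of `M × M`. [folklore] -/
theorem ezHChain_mem_smoothChains {c : CChain A M k} (hc : c ∈ smoothChains I R A M k) :
    ezHChain R A M k c ∈ smoothChains (I.prod I) R A (M × M) (k + 1) := by
  classical
  have hc' := (mem_smoothChains_iff c).1 hc
  have hsum : (∑ σ ∈ c.support, Finsupp.single σ (c σ)) = c := Finsupp.sum_single c
  rw [← hsum, map_sum]
  refine Submodule.sum_mem _ fun σ hσ ↦ ?_
  rw [ezHChain_single, ezHomotopy]
  exact realize₂_mem_smoothChains R A (hc' σ hσ) (hc' σ hσ) _ _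

/-- The diagonal of a smooth chain is a smooth chain of `M × M`. [folklore] -/
theorem diagChain_mem_smoothChains {c : CChain A M k} (hc : c ∈ smoothChains I R A M k) :
    diagChain R A M k c ∈ smoothChains (I.prod I) R A (M × M) k := by
  classical
  have hc' := (mem_smoothChains_iff c).1 hc
  have hsum : (∑ σ ∈ c.support, Finsupp.single σ (c σ)) = c := Finsupp.sum_single c
  rw [← hsum, map_sum]
  refine Submodule.sum_mem _ fun σ hσ ↦ ?_
  rw [diagChain_single]
  exact single_mem_smoothChains ((hc' σ hσ).pairSimplex (hc' σ hσ)) _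

/-! ### The cube parametrisation of a shuffle simplex -/

/-- The affine combination of the labelled vertices is the label map: for labels `a j ≤ p`,
`∑ⱼ xⱼ e_{aⱼ} = 𝔄_a x`. [folklore] -/
theorem sum_smul_vtx_eq_labelMap {a : Fin (k + 1) → ℕ} (ha : ∀ j, a j ≤ p) (x : Fin (k + 1) → ℝ) :
    (∑ j, x j • ((StdSimplex.vtx p (a j) : StdSimplex p) : Fin (p + 1) → ℝ)) = labelMap p a x := by
  funext i
  rw [labelMap_apply, Finset.sum_apply]
  refine Finset.sum_congr rfl fun j _ ↦ ?_
  rw [StdSimplex.vtx_eq_vertex (ha j), Pi.smul_apply, stdSimplex.vertex_coe, Pi.single_apply, smul_eq_mul, mul_ite,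
    mul_one, mul_zero]
  exact if_congr (by rw [Fin.ext_iff]; exact eq_comm) rfl rfl

/-- **The cube parametrisation of a shuffle simplex is the product of the cube parametrisations of
its factors**: along a tuple `w` of `shuffle n p` with `p + q = n`, on the cube,
`(σ,τ)_w.cubeMap t = (σ.cubeMap (S_w t), τ.cubeMap (T_w t))`. [folklore] -/
theorem cubeMap_tupleSimplex (σ : SingularSimplex M p) (τ : SingularSimplex N q) (hn : p + q = n)
    {w : Fin (n + 1) → V} (hw : w ∈ (shuffle n p).support) {t : Fin n → ℝ} (ht : t ∈ unitCube n) :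
    (tupleSimplex σ τ w).cubeMap t = (σ.cubeMap (cubeS p w t), τ.cubeMap (cubeT q w t)) := by
  have hbox := vertsIn_shuffle n p w hw
  have hmem := cubeToSimplex_mem_stdSimplex ht
  rw [cubeMap_apply, tupleSimplex, bext_pairSimplex]
  simp only
  rw [bext_compose_apply_of_mem _ _ hmem, bext_compose_apply_of_mem _ _ hmem,
    sum_smul_vtx_eq_labelMap (a := fun j ↦ (w j).1) (fun j ↦ (hbox j).1),
    sum_smul_vtx_eq_labelMap (a := fun j ↦ (w j).2) (fun j ↦ by have := (hbox j).2; omega),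
    show (fun j ↦ (w j).1) = Prod.fst ∘ w from rfl, show (fun j ↦ (w j).2) = Prod.snd ∘ w from rfl,
    labelMap_cubeToSimplex_fst hw, labelMap_cubeToSimplex_snd hn hw, cubeMap_apply, cubeMap_apply]

end Literature.AlgebraicTopology.SingularHomology.EilenbergZilber
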